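import Literature.Probability.Process.BrownianBridgeToPoint3Law
import Literature.Probability.Process.BrownianBridgeToPoint3Polar
import HarnessLib

/-!
# Kelvin covariance of the Brownian bridge-to-a-point in `ℝ³`: the avoidance form implies the
push-forward form

Topic `Literature/Probability/Process`; theorems only, everything PROVED. For the law
`P_{x→y} = brownianBridgeToPointRangeLaw3 x y` of the range of Brownian motion from `x` conditioned
to hit `y` (a random compact subset of `ℝ³`) and the unit inversion `ι` (support statement
`KelvinBridgeCovariance`, item `stmt-CriticalPhenomena-5033` of the route
`Summit.CriticalPhenomena.Ising3DConformalLimit.Theses.MoebiusRestrictionCurrents`):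

* `brownianBridgeToPointRangeLaw3_setOf_mem_eq_zero` — the range misses every given point
  `z ∉ {x, y}` almost surely (points are polar for the bridge, `BrownianBridgeToPoint3Polar`,
  integrated over the lifetime); in particular (`…_setOf_zero_mem_eq_zero`) the pole `0` of `ι`
  when `x, y ≠ 0`;
* `brownianBridgeToPointRangeLaw3_inversion_of_forall_setOf_disjoint` — **for `x ≠ y` in
  `ℝ³ ∖ {0}`: if `P_{ιx→ιy} {K | K ∩ ι '' U = ∅} = P_{x→y} {K | K ∩ U = ∅}` for every open `U ∌ 0`
  (the AVOIDANCE form of `KelvinBridgeCovariance`: by the bridge-mixture definition the two sides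
  are ratios of killed to free Green functions, `G_{ℝ³∖U}(x,y)/G(x,y)`), then
  `P_{ιx→ιy} = (P_{x→y}).map invImage` (the PUSH-FORWARD form, `invImage K = ι '' K`).** All side
  conditions of the abstract reduction `map_invImage_eq_of_forall_setOf_disjoint`
  (`BrownianBridgeToPoint3Law`: uniqueness of laws of random compact sets from their avoidance
  functional, Molchanov 2005 Thm. 1.13) are discharged: both laws are probability measures and
  neither charges `{K | 0 ∈ K}`.

What is NOT here: the avoidance identity itself — the Kelvin covariance
`G_{ιD}(ιx, ιy) = ‖x‖‖y‖ G_D(x, y)` of killed Green functions for arbitrary open `ℝ³ ∖ D`,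
equivalently M. Yor's theorem that `ι(B)` is a time change of the `‖·‖⁻¹`-transform of Brownian
motion (Revuz–Yor, Ch. VIII, Exercise (3.17)); with it, this file's last theorem yields
`KelvinBridgeCovariance` in push-forward form.

## References

* D. Revuz, M. Yor, *Continuous Martingales and Brownian Motion*, 3rd ed. (1999), Ch. VIII,
  Exercise (3.17) (inverting Brownian motion in space). [RevuzYor1999]
* J. L. Doob, *Classical Potential Theory and Its Probabilistic Counterpart* (1984), Part 2,
  Ch. X (`h`-path processes). [Doob1984]
* I. Molchanov, *Theory of Random Sets* (2005), Chap. 1, Thm. 1.13. [Molchanov2005]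
-/

noncomputable section

open MeasureTheory TopologicalSpace Set Metric EuclideanGeometry
open scoped NNReal ENNReal

namespace Literature.Probability.Process

open BrownianBridgeToPoint3

/-- **The range misses every given point other than the endpoints, almost surely**:
`P_{x→y} {K | z ∈ K} = 0` for `z ∉ {x, y}` (points are polar for the Brownian bridge in `ℝ³`,
`BrownianBridgeToPoint3.measure_mem_bridgeRange_eq_zero`, integrated over the lifetime). [folklore] -/
theorem brownianBridgeToPointRangeLaw3_setOf_mem_eq_zero {x y z : E3} (h : x ≠ y) (hzx : z ≠ x)
    (hzy : z ≠ y) : brownianBridgeToPointRangeLaw3 x y {K | z ∈ (K : Set E3)} = 0 := by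
  rw [brownianBridgeToPointRangeLaw3_apply h (measurableSet_setOf_mem z),
    Measure.prod_apply_symm ((measurable_bridgeRange_uncurry x y) (measurableSet_setOf_mem z))]
  have h0 : ∀ t : ℝ, wienerQuad ((fun ω : WienerQuad => (ω, t)) ⁻¹'
      ((fun p : WienerQuad × ℝ => bridgeRange p.2.toNNReal x y p.1) ⁻¹'
        {K : NonemptyCompacts E3 | z ∈ (K : Set E3)})) = 0 := fun t =>
    show wienerQuad {ω | z ∈ (bridgeRange t.toNNReal x y ω : Set E3)} = 0 from
      measure_mem_bridgeRange_eq_zero _ hzx hzy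
  rw [lintegral_congr h0, lintegral_zero]

/-- In particular the pole of the unit inversion is avoided: `P_{x→y} {K | 0 ∈ K} = 0` for
`x, y ≠ 0`, `x ≠ y`. [folklore] -/
theorem brownianBridgeToPointRangeLaw3_setOf_zero_mem_eq_zero {x y : E3} (h : x ≠ y) (hx : x ≠ 0)
    (hy : y ≠ 0) : brownianBridgeToPointRangeLaw3 x y {K | (0 : E3) ∈ (K : Set E3)} = 0 :=
  brownianBridgeToPointRangeLaw3_setOf_mem_eq_zero h hx.symm hy.symm

/-- **`KelvinBridgeCovariance`: the avoidance form implies the push-forward form.** For `x ≠ y`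
in `ℝ³ ∖ {0}`: if the bridge-to-a-point range from `ιx` to `ιy` misses `ι '' U` with the same
probability as the range from `x` to `y` misses `U`, for every open `U ∌ 0`, then the law from
`ιx` to `ιy` IS the image of the law from `x` to `y` under `invImage` (`K ↦ ι '' K`). All
hypotheses of `map_invImage_eq_of_forall_setOf_disjoint` are discharged here: both laws are
probability measures (`isProbabilityMeasure_brownianBridgeToPointRangeLaw3`) and neither charges
`{K | 0 ∈ K}` (`brownianBridgeToPointRangeLaw3_setOf_zero_mem_eq_zero`). [folklore] -/
theorem brownianBridgeToPointRangeLaw3_inversion_of_forall_setOf_disjoint {x y : E3} (hx : x ≠ 0)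
    (hy : y ≠ 0) (hxy : x ≠ y)
    (h : ∀ U : Set E3, IsOpen U → (0 : E3) ∉ U →
      brownianBridgeToPointRangeLaw3 (unitInv x) (unitInv y)
          {K | Disjoint (K : Set E3) (unitInv '' U)}
        = brownianBridgeToPointRangeLaw3 x y {K | Disjoint (K : Set E3) U}) :
    brownianBridgeToPointRangeLaw3 (unitInv x) (unitInv y)
      = (brownianBridgeToPointRangeLaw3 x y).map invImage := by
  have hιx : unitInv x ≠ 0 := fun h0 => hx (unitInv_eq_zero_iff.1 h0)
  have hιy : unitInv y ≠ 0 := fun h0 => hy (unitInv_eq_zero_iff.1 h0)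
  have hιxy : unitInv x ≠ unitInv y := fun h0 =>
    hxy ((inversion_involutive (0 : E3) one_ne_zero).injective h0)
  haveI := isProbabilityMeasure_brownianBridgeToPointRangeLaw3 hxy
  haveI := isProbabilityMeasure_brownianBridgeToPointRangeLaw3 hιxy
  refine map_invImage_eq_of_forall_setOf_disjoint _ _
    (brownianBridgeToPointRangeLaw3_setOf_zero_mem_eq_zero hxy hx hy)
    (brownianBridgeToPointRangeLaw3_setOf_zero_mem_eq_zero hιxy hιx hιy) ?_ h
  rw [measure_univ, measure_univ]

end Literature.Probability.Process
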